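import Summits.ResolutionOfSingularities.ResolutionOfSingularities.Theorems.EquisingularLiftEquisingularLiftNatAffineTwoStepChart
import Summits.ResolutionOfSingularities.ResolutionOfSingularities.Theorems.EquisingularLiftEquisingularLiftNatIsoHypPointOfPoints
import Summits.ResolutionOfSingularities.ResolutionOfSingularities.Theorems.EquisingularLiftEquisingularLiftNatHypersurfaceLinearCentreBlowup
import Summits.ResolutionOfSingularities.ResolutionOfSingularities.Theorems.EquisingularLiftEquisingularLiftNatSpecimenHypersurfaceChartRings
import HarnessLib

/-!
# [OURS] THE TWO-STEP VERTEX: a point of `V₊(F) ⊆ ℙⁿ` over a coordinate vertex whose vertex chart carries second-order data is a TWO-STEP POINT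
# (level `1` of every blow-up tower) — the level-1 bridge of the depth programme CLOSED from polynomial data to the lead's intrinsic currency
# (cruxes `Theses.EquisingularLift.EquisingularLiftNat` / `…NatThree` / `EquisingularLift`, stmt-ResolutionOfSingularities-20038 / -20148 / -15660)

[OURS · leafhand-res-equisingularlift-11 g0, 2026-08-31; cell `pub/decomp-res`] AI-produced, weaker than expert review; NOT a statement of any manuscript;
nothing here proves resolution of singularities in positive characteristic.  DEF-FREE helper; no `sorry`; standard axioms; ZERO named hypotheses.

* ★★★ `twoStepAt_vertex` — `F ∈ K[x₀,…,x_{m+2}]` a form of positive degree, `c` a coordinate, the vertex chart `F(x_c := 1) = Φ + Ψ` radical with the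
  second-order data of ✓ `OneStep.twoStepAt_origin` (per-chart strict transforms, disjunctive Jacobian datum, second-order splittings with one-step data).
  Then THE point `x₀ ∈ V₊(F)` over the vertex `P_c` (✓ `exists_vertexPoint`) is closed and TWO-STEP: for every blow-up `τ : Z → V₊(F)` along
  `vanishingIdeal {x₀}` a finite set of closed ONE-STEP points over `x₀` off which `Z` is regular over `x₀` — the hypothesis `htwo` of
  ✓ `PointChain.chain_of_twoStepPoints`, level `1` of ✓ `towerLevel_succ_of_model`.  Route: the open immersion
  `ψ = Spec θ ≫ chart F c : Spec K[y]/(Φ + Ψ) → V₊(F)` (✓ `HypersurfaceSpecimen.exists_chartQuotEquiv`, ✓ `chart`) sends the origin to `x₀` (the vertex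
  ideal pulls back to the origin ideal: ✓ `HypersurfaceSpecimen.comap_chart_eq_ofIdealTop`), and ✓ `OneStep.twoStepAt_of_affineChart`.

With ✓ …SecondOrderA3Recognition / …ALadder / …DLadder this yields «`A₃` / `A`-type with `c ≠ 0` / `D`-simple-root vertices are two-step», hence (S, next)
`IsoHypPoint` for prime forms whose singular points are such vertices (✓ `chain_of_twoStepPoints`).  Honest label: closes no registered stub.

References: [Hartshorne1977, I Thm. 5.1, II Prop. 5.9, II Ex. 7.12]; [StacksProject, Tags 0804, 080E]; through the cited tree files.
-/

set_option linter.dupNamespace false -- mandated namespace `Summit.<Summit>.<Problem>` of this single-conjunct summit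

noncomputable section

open CategoryTheory CategoryTheory.Limits AlgebraicGeometry TopologicalSpace
open Literature.AlgebraicGeometry.Resolution Literature.AlgebraicGeometry.Motives
open AlgebraicGeometry.Scheme.IdealSheafData
open MvPolynomial HomogeneousLocalization
open Literature.AlgebraicGeometry.Motives.SmoothHypersurface Literature.AlgebraicGeometry.Motives.ProjectiveSpace
open Summit.ResolutionOfSingularities.ResolutionOfSingularities.Cruxes.EquisingularLift.StrataSplit

namespace Summit.ResolutionOfSingularities.ResolutionOfSingularities.Cruxes.EquisingularLiftNat.Sections

/-- ★★★ **THE TWO-STEP VERTEX.** [OURS] [cite: Hartshorne1977, I Thm. 5.1, II Prop. 5.9] [cite: StacksProject, Tag 0804] -/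
theorem twoStepAt_vertex (K : Type) [Field K] {m : ℕ} (F : MvPolynomial (Fin (m + 2 + 1)) K) {d : ℕ} (hF : F.IsHomogeneous d) (hd : 0 < d)
    (c : Fin (m + 2 + 1)) (Φ Ψ : MvPolynomial (Fin (m + 2)) K) {μ : ℕ} (hμ : 1 ≤ μ) (hΦ : Φ.IsHomogeneous μ) (hΦ0 : Φ ≠ 0)
    (hΨ : Ψ ∈ Ideal.span (Set.range (X : Fin (m + 2) → MvPolynomial (Fin (m + 2)) K)) ^ (μ + 1))
    (hdeh : ProjectiveSpace.dehomogenize K c F = Φ + Ψ) (hrad : (Ideal.span {Φ + Ψ}).radical = Ideal.span {Φ + Ψ})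
    (G : Fin (m + 2) → MvPolynomial (Fin (m + 2)) K)
    (hG : ∀ a, aeval (fun j => X a * Function.update (X : Fin (m + 2) → MvPolynomial (Fin (m + 2)) K) a 1 j) (Φ + Ψ) = X a ^ μ * G a)
    (hjac : ∀ a, ∀ P : Ideal (MvPolynomial (Fin (m + 2)) K), P.IsPrime → (X a : MvPolynomial (Fin (m + 2)) K) ∈ P → G a ∈ P →
      (∃ j, pderiv j (G a) ∉ P) ∨ ∀ i, (X i : MvPolynomial (Fin (m + 2)) K) ∈ P)
    (hsec : ∀ a, G a ∈ Ideal.span (Set.range (X : Fin (m + 2) → MvPolynomial (Fin (m + 2)) K)) →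
      ∃ (μ' : ℕ) (Φ' Ψ' : MvPolynomial (Fin (m + 2)) K), 1 ≤ μ' ∧ Φ'.IsHomogeneous μ' ∧ Φ' ≠ 0 ∧
        Ψ' ∈ Ideal.span (Set.range (X : Fin (m + 2) → MvPolynomial (Fin (m + 2)) K)) ^ (μ' + 1) ∧ G a = Φ' + Ψ' ∧
        ∀ b : Fin (m + 2), ∃ G' : MvPolynomial (Fin (m + 2)) K,
          aeval (fun j => X b * Function.update (X : Fin (m + 2) → MvPolynomial (Fin (m + 2)) K) b 1 j) (Φ' + Ψ') = X b ^ μ' * G' ∧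
          ∀ P : Ideal (MvPolynomial (Fin (m + 2)) K), P.IsPrime → (X b : MvPolynomial (Fin (m + 2)) K) ∈ P → G' ∈ P → ∃ j, pderiv j G' ∉ P) :
    letI := MvPolynomial.gradedAlgebra (σ := Fin (m + 2 + 1)) (R := K)
    ∃ (x₀ : ↥(hypersurface F).left) (hx₀cl : IsClosed ({x₀} : Set ↥(hypersurface F).left)),
      (∀ a : Fin (m + 2 + 1), a ≠ c → (X a : MvPolynomial (Fin (m + 2 + 1)) K) ∈ ((hypersurfaceι F).left x₀).asHomogeneousIdeal) ∧
      ∀ (Z : Scheme.{0}) (τ : Z ⟶ (hypersurface F).left), IsBlowup τ (vanishingIdeal ⟨{x₀}, hx₀cl⟩) →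
        ∃ S' : Finset Z, (∀ z : Z, τ z = x₀ → z ∉ S' → IsRegularLocalRing (Z.presheaf.stalk z)) ∧
          ∀ z ∈ S', τ z = x₀ ∧ ∃ hz : IsClosed ({z} : Set Z), ∀ (Z' : Scheme.{0}) (τ' : Z' ⟶ Z),
            IsBlowup τ' (vanishingIdeal ⟨{z}, hz⟩) → ∀ z' : Z', τ' z' = z → IsRegularLocalRing (Z'.presheaf.stalk z') := by
  letI := MvPolynomial.gradedAlgebra (σ := Fin (m + 2 + 1)) (R := K)
  letI := MvPolynomial.gradedAlgebra (σ := Fin (0 + 1)) (R := K)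
  letI := ProjBaseChange.algebraBase (R := K) (homogeneousSubmodule (Fin (m + 2 + 1)) K)
    (Submonoid.powers (X c : MvPolynomial (Fin (m + 2 + 1)) K))
  classical
  -- the kill map of the vertex `P_c`
  have he : Function.Injective (fun _ : Fin 1 => c) := Function.injective_of_subsingleton _
  obtain ⟨fk, hfk', hfkC, hfke, hfk0⟩ := LinearCentre.exists_kill (R := K) (fun _ : Fin 1 => c) he
  have hfke' : ∀ j : Fin 1, fk (X c) = X j := fun j => hfke j
  have hfk0' : ∀ i : Fin (m + 2 + 1), i ≠ c → fk (X i) = 0 := fun i hi => hfk0 i (fun ⟨_, hj⟩ => hi hj.symm)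
  -- the vertex point
  obtain ⟨x₀, hx₀cl, hx₀cl', hsupp, hx₀X, hΛ, hcomap⟩ :=
    exists_vertexPoint K F hF c ⟨μ, Φ, Ψ, hμ, hΦ, hΨ, hdeh⟩ fk hfk' hfkC hfke' hfk0'
  refine ⟨x₀, hx₀cl', hx₀X, ?_⟩
  -- the chart `ψ = Spec θ ≫ chart F c`
  obtain ⟨θ, hθ⟩ := HypersurfaceSpecimen.exists_chartQuotEquiv F hF c (Φ + Ψ) hdeh hrad
  let ψ : Spec (CommRingCat.of (MvPolynomial (Fin (m + 2)) K ⧸ Ideal.span {Φ + Ψ})) ⟶ (hypersurface F).left :=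
    Spec.map θ.toCommRingCatIso.hom ≫ (chart F c hF hd).left
  haveI : IsOpenImmersion (Spec.map θ.toCommRingCatIso.hom) := IsOpenImmersion.of_isIso _
  haveI : @IsOpenImmersion (Spec (CommRingCat.of (ChartRing F c hF))) _ (chart F c hF hd).left :=
    isOpenImmersion_chart_left F c hF hd
  haveI : IsOpenImmersion ψ := IsOpenImmersion.comp _ _
  -- the origin and its image
  let y₀ : Spec (CommRingCat.of (MvPolynomial (Fin (m + 2)) K ⧸ Ideal.span {Φ + Ψ})) :=
    ⟨Ideal.map (Ideal.Quotient.mk (Ideal.span {Φ + Ψ})) (Ideal.span (Set.range (X : Fin (m + 2) → MvPolynomial (Fin (m + 2)) K))),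
      (OneStep.isMaximal_map_mk_span_range_X K Φ Ψ hμ hΦ hΨ).isPrime⟩
  have hy₀ : y₀.asIdeal = Ideal.map (Ideal.Quotient.mk (Ideal.span {Φ + Ψ}))
      (Ideal.span (Set.range (X : Fin (m + 2) → MvPolynomial (Fin (m + 2)) K))) := rfl
  -- the vertex ideal pulled back to the chart is the origin ideal of `ChartRing F c`
  have hchart := HypersurfaceSpecimen.comap_chart_eq_ofIdealTop K F hF hd (fun _ : Fin 1 => c) he fk hfk' hfkC hfke hfk0 c
  -- the origin ideal of `ChartRing F c` goes into the origin ideal of `K[y]/(f)` under `θ`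
  have hI₀ : ∀ q ∈ Ideal.span (Set.range fun a : {a : Fin (m + 2 + 1) // a ∉ Set.range (fun _ : Fin 1 => c)} => tautVec F c hF a.1),
      θ q ∈ y₀.asIdeal := by
    intro q hq
    have hle : Ideal.span (Set.range fun a : {a : Fin (m + 2 + 1) // a ∉ Set.range (fun _ : Fin 1 => c)} => tautVec F c hF a.1) ≤
        y₀.asIdeal.comap θ.toRingHom := by
      rw [Ideal.span_le]
      rintro _ ⟨⟨a, ha⟩, rfl⟩
      obtain ⟨j, hj⟩ : ∃ j : Fin (m + 2), c.succAbove j = a := Fin.exists_succAbove_eq (fun h => ha ⟨0, h.symm⟩)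
      rw [SetLike.mem_coe, Ideal.mem_comap]
      change θ (tautVec F c hF a) ∈ y₀.asIdeal
      rw [← hj, hθ j, hy₀]
      exact Ideal.mem_map_of_mem _ (Ideal.subset_span ⟨j, rfl⟩)
    exact hle hq
  have hψx : ψ y₀ = x₀ := by
    -- the point `p₀ = Spec θ (y₀)` of the chart lies on the pulled-back vertex ideal
    have hsurj : Function.Surjective (Scheme.ΓSpecIso (CommRingCat.of (ChartRing F c hF))).inv :=
      (ConcreteCategory.bijective_of_isIso (C := CommRingCat) (Scheme.ΓSpecIso (CommRingCat.of (ChartRing F c hF))).inv).2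
    have hinj : Function.Injective (Scheme.ΓSpecIso (CommRingCat.of (ChartRing F c hF))).inv :=
      (ConcreteCategory.bijective_of_isIso (C := CommRingCat) (Scheme.ΓSpecIso (CommRingCat.of (ChartRing F c hF))).inv).1
    -- the chart morphism with source typed as `Spec (ChartRing F c)`
    have hchart' : Scheme.IdealSheafData.comap (X := Spec (CommRingCat.of (ChartRing F c hF)))
        (((Proj.map fk hfk').ker.comap (hypersurfaceι F).left)) (chart F c hF hd).left =
        ofIdealTop ((Ideal.span (Set.range fun a : {a : Fin (m + 2 + 1) // a ∉ Set.range (fun _ : Fin 1 => c)} => tautVec F c hF a.1)).map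
          (Scheme.ΓSpecIso (CommRingCat.of (ChartRing F c hF))).inv.hom) := hchart
    have hp : Spec.map θ.toCommRingCatIso.hom y₀ ∈
        ((Scheme.IdealSheafData.comap (X := Spec (CommRingCat.of (ChartRing F c hF)))
          (((Proj.map fk hfk').ker.comap (hypersurfaceι F).left)) (chart F c hF hd).left).support :
            Set (Spec (CommRingCat.of (ChartRing F c hF)))) := by
      rw [hchart', Scheme.IdealSheafData.coe_support_ofIdealTop, Spec_zeroLocus, Spec.map_apply]
      refine (PrimeSpectrum.mem_zeroLocus _ _).mpr ?_
      intro r hr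
      obtain ⟨r', hr', hrr'⟩ := (Ideal.mem_map_iff_of_surjective _ hsurj).mp hr
      have hr'' : r = r' := hinj hrr'.symm
      subst hr''
      rw [SetLike.mem_coe, PrimeSpectrum.comap_asIdeal, Ideal.mem_comap]
      exact hI₀ r hr'
    rw [Scheme.IdealSheafData.support_comap] at hp
    change (chart F c hF hd).left (Spec.map θ.toCommRingCatIso.hom y₀) ∈
      ((((Proj.map fk hfk').ker.comap (hypersurfaceι F).left)).support : Set ↥(hypersurface F).left) at hp
    rw [hcomap, Scheme.IdealSheafData.coe_support_vanishingIdeal] at hp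
    exact hp
  exact OneStep.twoStepAt_of_affineChart K Φ Ψ hμ hΦ hΦ0 hΨ G hG hjac hsec y₀ hy₀ ψ hψx hx₀cl'

end Summit.ResolutionOfSingularities.ResolutionOfSingularities.Cruxes.EquisingularLiftNat.Sections

end
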